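import Summits.ResolutionOfSingularities.ResolutionOfSingularities.Theorems.StallVertexCompanion5
import HarnessLib

/-!
# StallVertexCompanion6 — decomp-res node «StallVertexCompanion (lens-5 g29, rev 10 of the node «StallVertex»;
critic row 192 CLEARED +1)», tree file 6/8 of the node

Content from the decomp-res lens-5 g29 node file `HOME/decomp-res-lens-5/g29/StallVertexCompanion.lean` (pin
deaa8fea) with the critic's ten mechanical lint fixes (fixed sha256 245dae5b; HOME =
run/shared/lean/pub/decomp-res); critic CRITIC-LEDGER row 192 CLEARED +1 — provenance, the fix list, critic text and
the lens header in full in part 2 of the node, `StallVertexCompanion`.  Namespace `…Theorems.StallVertex`;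
`--supports stmt-ResolutionOfSingularities-31770`.

## This file

Continuation 6/8 of `StallVertexCompanion` (same namespace and sections of the node, cut at the tree's 400-line cap;
section variables / opens replayed): `section WalkTangent` — carries `tangentAt_of_tangentAt_succ`, `youngExp_degree_lt`.

[WRITER NOTE (decomp-res writer g12): file split only (tree files ≤ 400 lines) plus the ten critic-ordered lint
fixes listed in `StallVertexCompanion`; namespace, sections, section variables / opens / `set_option maxHeartbeats …
in` lines and every declaration otherwise exactly as in the lens.]

(Sources: KawanoueMatsuki2012 arXiv:1205.4556 Prop. 3 (the companion (c_{f,𝕆}·𝕄^{-a}, μ̃·a)); Moh1987; Hauser2010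
(kangaroo points); HauserPerlega2019 §2; HauserPerlega2024; CossartPiltant2008 §2; CossartJannsenSaito2020 Ch. 8;
Benito–Villamayor (monomial case); Hironaka2005.)
-/

noncomputable section

open MvPolynomial Finset
open Literature.AlgebraicGeometry.Resolution
open Literature.AlgebraicGeometry.Resolution.Hauser2010
open Literature.AlgebraicGeometry.Resolution.HauserPerlega2024
open Literature.Barriers.ResolutionOfSingularities
open Literature.AlgebraicGeometry.Resolution.PointBlowup
open Summit.ResolutionOfSingularities.ResolutionOfSingularities.Theses
open Summit.ResolutionOfSingularities.ResolutionOfSingularities.Theorems.TightDefectClasses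
open Summit.ResolutionOfSingularities.ResolutionOfSingularities.Theorems.ProximityCut
open Summit.ResolutionOfSingularities.ResolutionOfSingularities.Theorems.ExitLaw
open Summit.ResolutionOfSingularities.ResolutionOfSingularities.Theorems.DifferentialShade

namespace Summit.ResolutionOfSingularities.ResolutionOfSingularities.Theorems.StallVertex

section WalkTangent

variable {K : Type} [Field K] [DecidableEq K]

set_option maxHeartbeats 1600000 in
/-- **T1 — TANGENCY IS NEVER REGAINED.**  On a positive skew stalled tail (the flat law in force), if the persisting
minimiser is tangent at `t + 1` then it is tangent at `t`, and the plane at `t` is the REHOMOGENISATION of the carried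
plane: `in(g_{t+1}) = u_j^E (A + u_j B)` with `A = in_n(dirForm_t)` (`move_eq_layer`); a tangent cone at `t + 1` forces
`A = r' u^{B(t)|_kept} (ℓ♭)^w` (`low_layer_of_cone`), and the attained move rebuilds the cone at `t` from its low layer
(`cone_of_low_layer`).  Contrapositive: once a minimiser's companion cone stops being a pure power it never becomes one
again — incompatible with `StaysOnNewest` infinitely often (T2, g30). [new] [folklore] -/
theorem tangentAt_of_tangentAt_succ {p e : ℕ} (hp : p.Prime) [CharP K p] {s₀ : State (Fin 3) K}
    (hs : IsRoot (p ^ e) s₀) (W : ForcedWalk (p ^ e) s₀) (N : ℕ)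
    (hstall : ∀ t, N ≤ t → (ifp W (t + 1)).muTilde (p ^ e) = (ifp W t).muTilde (p ^ e))
    (hskew : ∀ (k : Fin 3) (N' : ℕ), ∃ t, N' ≤ t ∧ (W.j t = k ∨ W.b t k ≠ 0))
    (hpos : (0 : WithTop ℚ) < (ifp W N).muTilde (p ^ e)) {t : ℕ} (ht : N ≤ t)
    {J₀ : Fin 3 →₀ ℕ} (hJ₀ : J₀ ∈ (ifp W t).idx)
    (hμ : (ifp W t).muP (p ^ e) = levelRatio (ordZero ((ifp W t).gen J₀)) (p ^ e - J₀.degree))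
    (h : TangentAt W (t + 1) J₀) : TangentAt W t J₀ := by
  classical
  obtain ⟨r', c', w, hr', hw, hord', hcomp', -⟩ := h
  have hst := hstall t ht
  have hg₀ne := gen_ne_zero_of_minimiser hp hs W t hμ
  obtain ⟨d₀, hd₀⟩ := exists_ordZero_eq_natCast hg₀ne
  have hledger := stall_ledger (p ^ e) (W.j t) (W.b t) (W.onExc t) (ifp W t) (fun J hJ => (level_bounds W t J hJ).2)
    (sing_ifp hp hs W t) (by rw [← ifp_succ]; exact hst.symm.le) hJ₀ hμ hd₀
  have hrig := stall_rigid (p ^ e) (W.j t) (W.b t) (W.onExc t) (ifp W t) (fun J hJ => (level_bounds W t J hJ).2)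
    (sing_ifp hp hs W t) (by rw [← ifp_succ]; exact hst.symm.le) hJ₀ hμ hd₀
  obtain ⟨hJ₀', hμ'⟩ := minimiser_succ hp hs W t hst hJ₀ hμ
  have hflat := flat_law hp hs W N hstall hskew
  have ha0 : 0 < p ^ e - J₀.degree := by have := (level_bounds W t J₀ hJ₀).2; omega
  -- abbreviations
  set a := p ^ e - J₀.degree with ha
  set j := W.j t with hj
  set b := W.b t with hb
  have hbj : b j = 0 := W.onExc t
  set G := (ifp W t).gen J₀ with hG
  set n := (ordZero (dirForm d₀ j b G)).toNat with hn
  have hTn : ordZero (dirForm d₀ j b G) = n := (coe_toNat_ordZero (dirForm_ne_zero j b hd₀)).symm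
  have had₀ : a ≤ d₀ := by
    have := sing_ifp hp hs W t J₀ hJ₀ hg₀ne; rw [hd₀] at this; exact_mod_cast this
  have hgen : (ifp W (t + 1)).gen J₀ = PointBlowup.translate b (chartTransform a j G) := by rw [ifp_succ]; rfl
  have hord2 : ordZero ((ifp W (t + 1)).gen J₀) = ((d₀ - a + n : ℕ) : ℕ∞) := by rw [ifp_succ]; exact hrig.2.1
  have hg'ne : (ifp W (t + 1)).gen J₀ ≠ 0 := gen_ne_zero_of_minimiser hp hs W (t + 1) hμ'
  -- the young letters at `t + 1` are `j` and the kept young letters of `t`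
  have hyoung' : (ifp W (t + 1)).young = insert j ((ifp W t).young.filter fun i => b i = 0) := by rw [ifp_succ]; rfl
  have hjy' : j ∈ (ifp W (t + 1)).young := by rw [hyoung']; exact Finset.mem_insert_self _ _
  have hkept' : ∀ i ∈ (ifp W (t + 1)).young, i ≠ j → i ∈ (ifp W t).young ∧ b i = 0 := by
    intro i hi hij
    rw [hyoung', Finset.mem_insert] at hi
    rcases hi with h | h
    · exact absurd h hij
    · exact Finset.mem_filter.mp h
  -- `n ≥ 1`
  have hpos_t : (0 : WithTop ℚ) < (ifp W t).muTilde (p ^ e) := by rw [muTilde_eq_of_stall W hstall ht]; exact hpos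
  have hn0 : n ≠ 0 := by
    intro h0
    apply ordZero_dirForm_ne_zero_of_stall_pos (p ^ e) j b hbj (ifp W t) (fun J hJ => (level_bounds W t J hJ).2)
      (sing_ifp hp hs W t) (by rw [← ifp_succ]; exact hst.symm.le) hpos_t hJ₀ hμ hd₀
    rw [hTn, h0, Nat.cast_zero]
  obtain ⟨m₁, hm₁⟩ : ∃ m₁, m₁ + 1 = n := ⟨n - 1, by omega⟩
  -- the two-layer form of `in(g_{t+1})`
  set A := homogeneousComponent n (dirForm d₀ j b G) with hA
  set B := homogeneousComponent m₁ (tailForm d₀ j b G) with hB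
  have hAne : A ≠ 0 := homogeneousComponent_ne_zero_of_ordZero_eq hTn
  have hAfree : ∀ e' ∈ A.support, e' j = 0 :=
    fun e' he' => dirForm_free d₀ b hbj G e' (mem_support_of_mem_support_homogeneousComponent he')
  have hlayer : homogeneousComponent (d₀ - a + n) ((ifp W (t + 1)).gen J₀) = X j ^ (d₀ - a) * (A + X j * B) := by
    rw [hgen, move_eq_layer b hbj had₀ hd₀, homogeneousComponent_X_pow_mul, map_add]
    congr 2
    have h1 := homogeneousComponent_X_pow_mul j 1 m₁ (tailForm d₀ j b G)
    rw [pow_one, add_comm, hm₁] at h1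
    exact h1
  -- the new exceptional letter: `ord_{u_j} g_{t+1} = d₀ - a`
  have hεj : (divisorOrder j ((ifp W (t + 1)).gen J₀)).toNat = d₀ - a := by
    apply le_antisymm
    · obtain ⟨e₁, he₁⟩ := MvPolynomial.ne_zero_iff.mp hAne
      have hmem : e₁ + Finsupp.single j (d₀ - a) ∈ ((ifp W (t + 1)).gen J₀).support := by
        apply mem_support_of_mem_support_homogeneousComponent (d := d₀ - a + n)
        rw [MvPolynomial.mem_support_iff, hlayer,
          coeff_two_layer_low j (d₀ - a) A B (hAfree e₁ (MvPolynomial.mem_support_iff.mpr he₁))]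
        exact he₁
      have h := divisorOrder_le_exponent (i := j) hmem
      rw [← ENat.coe_toNat (divisorOrder_ne_top (i := j) hg'ne), Nat.cast_le, Finsupp.add_apply,
        hAfree e₁ (MvPolynomial.mem_support_iff.mpr he₁), Finsupp.single_eq_same, zero_add] at h
      exact h
    · have h := le_divisorOrder_new b hbj a G
      rw [← hgen, hd₀, ENat.toNat_coe, ← ENat.coe_toNat (divisorOrder_ne_top (i := j) hg'ne), Nat.cast_le] at h
      exact h
  -- the kept young letters keep their divisor orders (flat law at `t` and `t+1`, `stall_ledger` (6))
  have hεkept : ∀ i ∈ (ifp W (t + 1)).young, i ≠ j →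
      (divisorOrder i ((ifp W (t + 1)).gen J₀)).toNat = (divisorOrder i G).toNat := by
    intro i hi hij
    obtain ⟨hiy, hbi⟩ := hkept' i hi hij
    have h6 := hledger.1 i hiy hij hbi
    rw [← ifp_succ] at h6
    have hf' := hflat (t + 1) (by omega) J₀ hJ₀' hμ' i hi
    have hf := hflat t ht J₀ hJ₀ hμ i hiy
    unfold NondefAt at hf hf'
    rw [h6, hf, ← ENat.coe_toNat (divisorOrder_ne_top (i := i) hg₀ne),
      ← ENat.coe_toNat (divisorOrder_ne_top (i := i) hg'ne)] at hf'
    exact (levelRatio_natCast_inj ha0 hf').symm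
  -- the young exponent at `t + 1` splits off the chart letter
  set S'' : Fin 3 →₀ ℕ := ∑ i ∈ ((ifp W (t + 1)).young).erase j,
    Finsupp.single i (divisorOrder i ((ifp W (t + 1)).gen J₀)).toNat with hS''
  have hS''_apply : ∀ i, S'' i = if i ∈ ((ifp W (t + 1)).young).erase j then
      (divisorOrder i ((ifp W (t + 1)).gen J₀)).toNat else 0 := by
    intro i
    rw [hS'', Finsupp.coe_finsetSum, Finset.sum_apply]
    simp_rw [Finsupp.single_apply]
    exact Finset.sum_ite_eq' _ i _
  have hS''j : S'' j = 0 := by rw [hS''_apply, if_neg (Finset.notMem_erase j _)]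
  have hY' : youngExp W (t + 1) J₀ = S'' + Finsupp.single j (d₀ - a) := by
    unfold youngExp
    rw [← Finset.add_sum_erase _ _ hjy', hεj, add_comm]
  have hkey : X j ^ (d₀ - a) * (A + X j * B) =
      monomial (S'' + Finsupp.single j (d₀ - a)) r' * (∑ i, C (c' i) * X i) ^ w := by
    have hdeg' : (youngExp W (t + 1) J₀).degree + w = d₀ - a + n := by
      have := hord'.symm.trans hord2; exact_mod_cast this
    rw [← hlayer, ← hY', ← hdeg', hcomp']
  -- A2: the low layer is the pure power of the carried plane
  have hA2 := low_layer_of_cone j (d₀ - a) B hAfree S'' hS''j r' c' w hkey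
  -- the carried plane is non-zero
  have hl : ∃ i, Function.update c' j 0 i ≠ 0 := by
    by_contra hnone
    push Not at hnone
    apply hAne
    rw [hA2, show (∑ i, C (Function.update c' j 0 i) * X i : MvPolynomial (Fin 3) K) = 0 from
      Finset.sum_eq_zero fun i _ => by rw [hnone i, C_0, zero_mul], zero_pow hw.ne', mul_zero]
  -- the attained data of move `t` (`stall_ledger` (8))
  set ε : Fin 3 → ℕ := fun i => (divisorOrder i G).toNat with hε
  set S : Finset (Fin 3) := (ifp W t).young.filter fun i => b i ≠ 0 with hSdef
  have hjS : j ∉ S := by rw [hSdef, Finset.mem_filter, not_and, not_not]; exact fun _ => hbj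
  set sx : Fin 3 →₀ ℕ := ∑ i ∈ S, Finsupp.single i (ε i) with hsx
  have hsx_apply : ∀ i, sx i = if i ∈ S then ε i else 0 := by
    intro i
    rw [hsx, Finsupp.coe_finsetSum, Finset.sum_apply]
    simp_rw [Finsupp.single_apply]
    exact Finset.sum_ite_eq' S i ε
  set kx : ℕ := if j ∈ (ifp W t).young then ε j else 0 with hkx
  have hεle : ∀ e' ∈ G.support, ∀ i, ε i ≤ e' i := fun e' he' i => by
    have h := divisorOrder_le_exponent (i := i) he'
    rw [← ENat.coe_toNat (divisorOrder_ne_top (i := i) hg₀ne)] at h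
    exact_mod_cast h
  have hGx : ∀ e' ∈ G.support, sx ≤ e' ∧ kx ≤ e' j := by
    intro e' he'
    refine ⟨fun i => ?_, ?_⟩
    · rw [hsx_apply]
      split_ifs
      · exact hεle e' he' i
      · exact Nat.zero_le _
    · rw [hkx]
      split_ifs
      · exact hεle e' he' j
      · exact Nat.zero_le _
  have hsxj : sx j = 0 := by rw [hsx_apply, if_neg hjS]
  have hsxb : ∀ i, sx i ≠ 0 → b i ≠ 0 := by
    intro i hi
    rw [hsx_apply] at hi
    split_ifs at hi with h
    · exact (Finset.mem_filter.mp h).2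
    · exact absurd rfl hi
  have hatt : n + (sx.degree + kx) = d₀ := hledger.2.2
  have hm : ∀ i, S'' i ≠ 0 → i ≠ j ∧ b i = 0 := by
    intro i hi
    rw [hS''_apply] at hi
    split_ifs at hi with h
    · obtain ⟨hij, hiy⟩ := Finset.mem_erase.mp h
      exact ⟨hij, (hkept' i hiy hij).2⟩
    · exact absurd rfl hi
  -- A3: rebuild the cone at `t`
  have hA3 := cone_of_low_layer j b hbj hd₀ sx hsxj hsxb kx hGx hTn hatt S'' hm hr' (Function.update c' j 0)
    (Function.update_self ..) hl w hA2
  -- the exponent is the young exponent at `t`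
  have hexp : S'' + sx + Finsupp.single j kx = youngExp W t J₀ := by
    ext i
    rw [Finsupp.add_apply, Finsupp.add_apply, hS''_apply, hsx_apply, youngExp_apply, Finsupp.single_apply, hkx]
    by_cases hij : i = j
    · subst hij
      rw [if_neg (Finset.notMem_erase _ _), if_neg hjS, zero_add, zero_add, if_pos rfl]
    · rw [if_neg (Ne.symm hij), add_zero]
      by_cases hiy : i ∈ (ifp W t).young
      · rw [if_pos hiy]
        by_cases hbi : b i = 0
        · have hi' : i ∈ (ifp W (t + 1)).young := by
            rw [hyoung']; exact Finset.mem_insert_of_mem (Finset.mem_filter.mpr ⟨hiy, hbi⟩)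
          rw [if_pos (Finset.mem_erase.mpr ⟨hij, hi'⟩), hεkept i hi' hij, if_neg, add_zero]
          rw [hSdef, Finset.mem_filter, not_and, not_not]; exact fun _ => hbi
        · rw [if_neg, if_pos (by rw [hSdef, Finset.mem_filter]; exact ⟨hiy, hbi⟩), zero_add]
          intro h
          exact hbi (hkept' i (Finset.mem_erase.mp h).2 hij).2
      · rw [if_neg hiy, if_neg, if_neg, add_zero]
        · rw [hSdef, Finset.mem_filter, not_and]; exact fun h => absurd h hiy
        · intro h
          exact hiy (hkept' i (Finset.mem_erase.mp h).2 hij).1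
  rw [hexp, Function.update_idem] at hA3
  -- degree count and conclusion
  set L : MvPolynomial (Fin 3) K :=
    ∑ i, C (Function.update c' j (-(∑ i, Function.update c' j 0 i * b i)) i) * X i with hL
  have hρ : r' * (∏ i, b i ^ (sx i))⁻¹ ≠ 0 := by
    refine mul_ne_zero hr' (inv_ne_zero (Finset.prod_ne_zero_iff.mpr fun i _ => ?_))
    by_cases hsi : sx i = 0
    · rw [hsi, pow_zero]; exact one_ne_zero
    · exact pow_ne_zero _ (hsxb i hsi)
  have hdeg : (youngExp W t J₀).degree + w = d₀ := by
    have h1 : (monomial (youngExp W t J₀) (r' * (∏ i, b i ^ (sx i))⁻¹) * L ^ w).IsHomogeneous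
        ((youngExp W t J₀).degree + w) :=
      (isHomogeneous_monomial _ rfl).mul (by simpa using (isHomogeneous_linear _).pow w)
    have h2 : (monomial (youngExp W t J₀) (r' * (∏ i, b i ^ (sx i))⁻¹) * L ^ w).IsHomogeneous d₀ := by
      rw [← hA3]; exact homogeneousComponent_isHomogeneous d₀ _
    refine h1.inj_right h2 ?_
    rw [← hA3]; exact homogeneousComponent_ne_zero_of_ordZero_eq hd₀
  refine ⟨r' * (∏ i, b i ^ (sx i))⁻¹, Function.update c' j (-(∑ i, Function.update c' j 0 i * b i)), w, hρ, hw,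
    by rw [hdeg, hd₀], by rw [hdeg, hA3], ?_⟩
  -- the rehomogenised plane passes through the direction
  rw [← Finset.add_sum_erase _ _ (Finset.mem_univ j), Function.update_self, Function.update_self, mul_one,
    ← Finset.add_sum_erase _ _ (Finset.mem_univ j), Function.update_self, zero_mul, zero_add]
  rw [show ∑ i ∈ Finset.univ.erase j, Function.update c' j (-(∑ i ∈ Finset.univ.erase j,
      Function.update c' j 0 i * b i)) i * Function.update b j 1 i =
      ∑ i ∈ Finset.univ.erase j, Function.update c' j 0 i * b i from Finset.sum_congr rfl fun i hi => by
        have hij : i ≠ j := Finset.ne_of_mem_erase hi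
        rw [Function.update_of_ne hij, Function.update_of_ne hij, Function.update_of_ne hij]]
  ring

/-- On the positive leaf the young exponent is a PROPER part of the order: `|B(t)| < d₀` (`companion_level`:
`μ̃ = (d₀ − |B(t)|)/a₀ > 0`). [new] [folklore] -/
theorem youngExp_degree_lt {p e : ℕ} (hp : p.Prime) [CharP K p] {s₀ : State (Fin 3) K}
    (hs : IsRoot (p ^ e) s₀) (W : ForcedWalk (p ^ e) s₀) (N : ℕ)
    (hstall : ∀ t, N ≤ t → (ifp W (t + 1)).muTilde (p ^ e) = (ifp W t).muTilde (p ^ e))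
    (hskew : ∀ (k : Fin 3) (N' : ℕ), ∃ t, N' ≤ t ∧ (W.j t = k ∨ W.b t k ≠ 0))
    (hpos : (0 : WithTop ℚ) < (ifp W N).muTilde (p ^ e)) {t : ℕ} (ht : N ≤ t)
    {J₀ : Fin 3 →₀ ℕ} (hJ₀ : J₀ ∈ (ifp W t).idx)
    (hμ : (ifp W t).muP (p ^ e) = levelRatio (ordZero ((ifp W t).gen J₀)) (p ^ e - J₀.degree))
    {d₀ : ℕ} (hd₀ : ordZero ((ifp W t).gen J₀) = d₀) : (youngExp W t J₀).degree < d₀ := by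
  classical
  have hlev := companion_level hp hs W N hstall hskew ht hJ₀ hμ hd₀
  have hpos_t : (0 : WithTop ℚ) < (ifp W t).muTilde (p ^ e) := by rw [muTilde_eq_of_stall W hstall ht]; exact hpos
  rw [hlev, ← WithTop.coe_zero, WithTop.coe_lt_coe] at hpos_t
  have ha : (0 : ℚ) < ((p ^ e - J₀.degree : ℕ) : ℚ) := by
    have := (level_bounds W t J₀ hJ₀).2
    exact_mod_cast (show 0 < p ^ e - J₀.degree by omega)
  have h := (div_pos_iff_of_pos_right ha).mp hpos_t
  have hdeg : ((youngExp W t J₀).degree : ℚ) =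
      ∑ i ∈ (ifp W t).young, ((divisorOrder i ((ifp W t).gen J₀)).toNat : ℚ) := by
    unfold youngExp
    rw [map_sum]
    push_cast
    exact Finset.sum_congr rfl fun i _ => by rw [Finsupp.degree_single]
  have hlt : ((youngExp W t J₀).degree : ℚ) < d₀ := by rw [hdeg]; linarith
  exact_mod_cast hlt

end WalkTangent

end Summit.ResolutionOfSingularities.ResolutionOfSingularities.Theorems.StallVertex
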